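import Mathlib.Algebra.MvPolynomial.Monad
import Mathlib.Algebra.CharP.Two
import Mathlib.RingTheory.MvPolynomial.Basic
import Mathlib.Tactic.LinearCombination
import Literature.Computability.QuantumComplexity.CubicForrelation
import Literature.Computability.QuantumComplexity.IQPForrelation

/-!
# Crux `CubicForrelation.NearExactIsExact` (stmt-QuantumAdvantage-14043), stub `stub_derivDegree`

Line `direct-sum-amplification`, stub D (`stub_derivDegree`, KNOWN/folklore): a discrete
derivative `x ↦ e(x) ⊕ e(x ⊕ t)` of a Boolean function `e` of algebraic degree `≤ d + 1` has
algebraic degree `≤ d` (Carlet, *Boolean Functions for Cryptography and Coding Theory* (2020/21),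
§2.2: `deg D_t f ≤ deg f − 1`).

In the tree's vocabulary `IsDegLeFun d f := ∃ p : MvPolynomial (Fin n) (ZMod 2),
p.totalDegree ≤ d ∧ ∀ x, f x = polyPhase p x` (the representing polynomial need NOT be
multilinear).  Proof: if `e = polyPhase p` with `p.totalDegree ≤ d + 1`, let `q` be the
TRANSLATE of `p` by `t`, i.e. the substitution `X j ↦ X j + C [t j]` (`MvPolynomial.bind₁`).
Then `q(x) = p(x ⊕ t)` pointwise (`dd_eval_shift`, `dd_point`), so the derivative is
`polyPhase (p + q)` (`[a + b = 1] = [a = 1] ⊕ [b = 1]` in `𝔽₂`, as in `Negative.polyPhase_add`), and `totalDegree (p + q) ≤ d`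
because the top homogeneous part of a polynomial is translation invariant.  The last point is
done monomial by monomial (`MvPolynomial.as_sum`; over `𝔽₂` every support coefficient is `1`):
for a monomial `X^s` and any substitution `f` with `deg (f j) ≤ 1` and `X j + f j` constant,
`X^s + f^s` is either `0` or of total degree `< |s|` (`dd_monomial`), proved by
`Finsupp.induction_linear` from the telescoping identity (characteristic `2`)
`X^{s₁+s₂} + f^{s₁+s₂} = X^{s₁} · (X^{s₂} + f^{s₂}) + (X^{s₁} + f^{s₁}) · f^{s₂}` (`dd_add`,
degree bookkeeping `dd_key`).

Everything is proved from Mathlib's `MvPolynomial` API and the tree (`polyPhase_apply`); no named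
facts.  Sources: C. Carlet (2021) §2.2 (derivatives and the Reed–Muller filtration); F. J.
MacWilliams, N. J. A. Sloane, *The Theory of Error-Correcting Codes* (1977), Ch. 13 §3.
-/

set_option linter.dupNamespace false -- D-0017: single-problem summit ⇒ `QuantumAdvantage.QuantumAdvantage` by design

namespace Summit.QuantumAdvantage.QuantumAdvantage.Theorems.CubicForrelation.NearExactIsExact

open Finset
open MvPolynomial
open Literature.Computability.QuantumComplexity
open Literature.Computability.QuantumComplexity.BuzetChailloux (bxor zeroVec signOf_sq)

variable {n : ℕ}

/-! ### Degree bookkeeping for the translate of a monomial -/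

/-- Degree bookkeeping of the telescoping step: if `D₁` is `0` or of degree `< a`, `D₂` is `0` or of
degree `< b`, `deg T₁ ≤ a` and `deg Φ₂ ≤ b`, then `T₁ D₂ + D₁ Φ₂` is `0` or of degree `< a + b`. -/
theorem dd_key (T₁ Φ₂ D₁ D₂ : MvPolynomial (Fin n) (ZMod 2)) (a b : ℕ)
    (hT : T₁.totalDegree ≤ a) (hΦ : Φ₂.totalDegree ≤ b)
    (h₁ : D₁.totalDegree + 1 ≤ a ∨ D₁ = 0) (h₂ : D₂.totalDegree + 1 ≤ b ∨ D₂ = 0) :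
    (T₁ * D₂ + D₁ * Φ₂).totalDegree + 1 ≤ a + b ∨ T₁ * D₂ + D₁ * Φ₂ = 0 := by
  rcases h₁ with h₁ | rfl <;> rcases h₂ with h₂ | rfl
  · left
    have hA := totalDegree_add (T₁ * D₂) (D₁ * Φ₂)
    have hB := totalDegree_mul T₁ D₂
    have hC := totalDegree_mul D₁ Φ₂
    omega
  · left
    rw [mul_zero, zero_add]
    have hC := totalDegree_mul D₁ Φ₂
    omega
  · left
    rw [zero_mul, add_zero]
    have hB := totalDegree_mul T₁ D₂
    omega
  · right
    rw [mul_zero, zero_mul, add_zero]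

/-- A substitution by polynomials of degree `≤ 1` maps the monomial `X^s` to a polynomial of total
degree `≤ |s|`. -/
theorem dd_shift_deg (f : Fin n → MvPolynomial (Fin n) (ZMod 2))
    (hf1 : ∀ j, (f j).totalDegree ≤ 1) (s : Fin n →₀ ℕ) :
    (bind₁ f (monomial s (1 : ZMod 2))).totalDegree ≤ s.sum fun _ e => e := by
  rw [bind₁_monomial, C_1, one_mul]
  refine (totalDegree_finsetProd _ _).trans ?_
  show ∑ i ∈ s.support, (f i ^ s i).totalDegree ≤ ∑ i ∈ s.support, s i
  exact Finset.sum_le_sum fun i _ =>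
    (totalDegree_pow _ _).trans ((Nat.mul_le_mul_left _ (hf1 i)).trans_eq (mul_one _))

/-- Telescoping step: if `X^{s₁} + f^{s₁}` and `X^{s₂} + f^{s₂}` are `0` or of degree `< |s₁|`,
`< |s₂|`, then `X^{s₁+s₂} + f^{s₁+s₂} = X^{s₁}(X^{s₂} + f^{s₂}) + (X^{s₁} + f^{s₁}) f^{s₂}`
(characteristic `2`) is `0` or of degree `< |s₁| + |s₂|`. -/
theorem dd_add (f : Fin n → MvPolynomial (Fin n) (ZMod 2)) (hf1 : ∀ j, (f j).totalDegree ≤ 1)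
    {s₁ s₂ : Fin n →₀ ℕ}
    (h₁ : (monomial s₁ (1 : ZMod 2) + bind₁ f (monomial s₁ 1)).totalDegree + 1 ≤
        (s₁.sum fun _ e => e) ∨ monomial s₁ (1 : ZMod 2) + bind₁ f (monomial s₁ 1) = 0)
    (h₂ : (monomial s₂ (1 : ZMod 2) + bind₁ f (monomial s₂ 1)).totalDegree + 1 ≤
        (s₂.sum fun _ e => e) ∨ monomial s₂ (1 : ZMod 2) + bind₁ f (monomial s₂ 1) = 0) :
    (monomial (s₁ + s₂) (1 : ZMod 2) + bind₁ f (monomial (s₁ + s₂) 1)).totalDegree + 1 ≤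
        ((s₁ + s₂).sum fun _ e => e) ∨
      monomial (s₁ + s₂) (1 : ZMod 2) + bind₁ f (monomial (s₁ + s₂) 1) = 0 := by
  have h2 : (2 : MvPolynomial (Fin n) (ZMod 2)) = 0 := CharTwo.two_eq_zero
  have hmul : (monomial (s₁ + s₂) (1 : ZMod 2) : MvPolynomial (Fin n) (ZMod 2)) =
      monomial s₁ 1 * monomial s₂ 1 := by
    rw [monomial_mul, one_mul]
  have hD : monomial (s₁ + s₂) (1 : ZMod 2) + bind₁ f (monomial (s₁ + s₂) 1) =
      monomial s₁ 1 * (monomial s₂ 1 + bind₁ f (monomial s₂ 1)) +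
        (monomial s₁ 1 + bind₁ f (monomial s₁ 1)) * bind₁ f (monomial s₂ 1) := by
    rw [hmul, map_mul]
    linear_combination (-(monomial s₁ (1 : ZMod 2) * bind₁ f (monomial s₂ 1))) * h2
  have hdeg : ((s₁ + s₂).sum fun _ e => e) = (s₁.sum fun _ e => e) + (s₂.sum fun _ e => e) :=
    Finsupp.sum_add_index' (fun _ => rfl) (fun _ _ _ => rfl)
  rw [hD, hdeg]
  exact dd_key _ _ _ _ _ _ (totalDegree_monomial s₁ one_ne_zero).le (dd_shift_deg f hf1 s₂) h₁ h₂

/-- Base case `s = 0`: `X^0 + f^0 = 1 + 1 = 0` in characteristic `2`. -/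
theorem dd_zero (f : Fin n → MvPolynomial (Fin n) (ZMod 2)) :
    (monomial 0 (1 : ZMod 2) + bind₁ f (monomial 0 1)).totalDegree + 1 ≤
        ((0 : Fin n →₀ ℕ).sum fun _ e => e) ∨
      monomial 0 (1 : ZMod 2) + bind₁ f (monomial 0 1) = 0 := by
  right
  rw [← C_apply, C_1, map_one]
  exact CharTwo.add_self_eq_zero 1

/-- Powers of one variable: if `deg (f a) ≤ 1` and `X a + f a` is a constant, then
`X a ^ b + (f a) ^ b` is `0` or of degree `< b`. -/
theorem dd_single (f : Fin n → MvPolynomial (Fin n) (ZMod 2)) (hf1 : ∀ j, (f j).totalDegree ≤ 1)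
    (hf0 : ∀ j, (X j + f j).totalDegree = 0) (a : Fin n) :
    ∀ b : ℕ, (monomial (Finsupp.single a b) (1 : ZMod 2) +
          bind₁ f (monomial (Finsupp.single a b) 1)).totalDegree + 1 ≤
        ((Finsupp.single a b).sum fun _ e => e) ∨
      monomial (Finsupp.single a b) (1 : ZMod 2) + bind₁ f (monomial (Finsupp.single a b) 1) = 0 := by
  have hone : (monomial (Finsupp.single a 1) (1 : ZMod 2) +
          bind₁ f (monomial (Finsupp.single a 1) 1)).totalDegree + 1 ≤
        ((Finsupp.single a 1).sum fun _ e => e) ∨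
      monomial (Finsupp.single a 1) (1 : ZMod 2) + bind₁ f (monomial (Finsupp.single a 1) 1) = 0 := by
    left
    have hX : (monomial (Finsupp.single a 1) (1 : ZMod 2) : MvPolynomial (Fin n) (ZMod 2)) = X a :=
      rfl
    rw [hX, bind₁_X_right, hf0, Finsupp.sum_single_index rfl]
  intro b
  induction b with
  | zero => rw [Finsupp.single_zero]; exact dd_zero f
  | succ b ih => rw [Finsupp.single_add]; exact dd_add f hf1 ih hone

/-- Every monomial: for a substitution `f` by polynomials of degree `≤ 1` with all `X j + f j`
constant (e.g. a translation `X j ↦ X j + c j`), `X^s + f^s` is `0` or of total degree `< |s|`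
(the top homogeneous part is translation invariant). -/
theorem dd_monomial (f : Fin n → MvPolynomial (Fin n) (ZMod 2))
    (hf1 : ∀ j, (f j).totalDegree ≤ 1) (hf0 : ∀ j, (X j + f j).totalDegree = 0)
    (s : Fin n →₀ ℕ) :
    (monomial s (1 : ZMod 2) + bind₁ f (monomial s 1)).totalDegree + 1 ≤ (s.sum fun _ e => e) ∨
      monomial s (1 : ZMod 2) + bind₁ f (monomial s 1) = 0 := by
  induction s using Finsupp.induction_linear with
  | zero => exact dd_zero f
  | add s₁ s₂ h₁ h₂ => exact dd_add f hf1 h₁ h₂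
  | single a b => exact dd_single f hf1 hf0 a b

/-- In `𝔽₂` a nonzero scalar is `1`. -/
theorem dd_zmod2_eq_one : ∀ a : ZMod 2, a ≠ 0 → a = 1 := by
  decide

/-- Translation lowers the degree of the difference: if `p.totalDegree ≤ d + 1` then
`p + f(p)` has total degree `≤ d` for every substitution `f` as in `dd_monomial`. -/
theorem dd_totalDegree (f : Fin n → MvPolynomial (Fin n) (ZMod 2))
    (hf1 : ∀ j, (f j).totalDegree ≤ 1) (hf0 : ∀ j, (X j + f j).totalDegree = 0) {d : ℕ}
    {p : MvPolynomial (Fin n) (ZMod 2)} (hp : p.totalDegree ≤ d + 1) :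
    (p + bind₁ f p).totalDegree ≤ d := by
  have hp' : ∑ s ∈ p.support, monomial s (1 : ZMod 2) = p := by
    conv_rhs => rw [p.as_sum]
    exact Finset.sum_congr rfl fun s hs => by rw [dd_zmod2_eq_one _ (mem_support_iff.mp hs)]
  have hsum : p + bind₁ f p = ∑ s ∈ p.support, (monomial s (1 : ZMod 2) + bind₁ f (monomial s 1)) := by
    rw [Finset.sum_add_distrib, ← map_sum (bind₁ f), hp']
  rw [hsum]
  refine totalDegree_finsetSum_le fun s hs => ?_
  rcases dd_monomial f hf1 hf0 s with h | h
  · have := le_totalDegree hs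
    omega
  · rw [h, totalDegree_zero]
    exact Nat.zero_le _

/-! ### Evaluating the translate -/

/-- Evaluating the translate `p(X + c)` at `x` is evaluating `p` at `x + c`. -/
theorem dd_eval_shift (c x : Fin n → ZMod 2) (p : MvPolynomial (Fin n) (ZMod 2)) :
    MvPolynomial.eval x (bind₁ (fun j => X j + C (c j)) p) =
      MvPolynomial.eval (fun j => x j + c j) p := by
  have h : MvPolynomial.eval x (bind₁ (fun j => X j + C (c j)) p) =
      MvPolynomial.eval (fun j => MvPolynomial.eval x (X j + C (c j))) p :=
    eval₂Hom_bind₁ (RingHom.id _) x _ p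
  rw [h]
  simp only [map_add, eval_X, eval_C]

/-- The `𝔽₂`-point of `x ⊕ t` is the sum of the `𝔽₂`-points of `x` and `t`, coordinatewise. -/
theorem dd_point : ∀ a b : Bool,
    (if (a ^^ b) then (1 : ZMod 2) else 0) = (if a then (1 : ZMod 2) else 0) + (if b then 1 else 0) := by
  decide

/-! ### The stub -/

/-- **stub_derivDegree** (D; KNOWN, folklore — Carlet 2021 §2.2: `deg D_t f ≤ deg f − 1`). A discrete
derivative `x ↦ e(x) ⊕ e(x ⊕ t)` of a function of algebraic degree `≤ d + 1` has algebraic degree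
`≤ d`: represent `e` by `p` with `totalDegree p ≤ d + 1`; the derivative is represented by
`p + p(X + t)`, whose total degree is `≤ d` because the top homogeneous part of a polynomial is
translation invariant (`dd_totalDegree`). -/
theorem stub_derivDegree :
    ∀ (n d : ℕ) (e : (Fin n → Bool) → Bool) (t : Fin n → Bool), IsDegLeFun (d + 1) e →
      IsDegLeFun d (fun x => e x ^^ e (bxor x t)) := by
  intro n d e t he
  obtain ⟨p, hp, hpe⟩ := he
  have hf1 : ∀ j : Fin n,
      (X j + C (if t j then (1 : ZMod 2) else 0) : MvPolynomial (Fin n) (ZMod 2)).totalDegree ≤ 1 :=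
    fun j => (totalDegree_add _ _).trans
      (max_le (totalDegree_X _).le ((totalDegree_C _).le.trans (Nat.zero_le _)))
  have hf0 : ∀ j : Fin n,
      (X j + (X j + C (if t j then (1 : ZMod 2) else 0)) : MvPolynomial (Fin n) (ZMod 2)).totalDegree
        = 0 := fun j => by
    rw [← add_assoc, CharTwo.add_self_eq_zero, zero_add, totalDegree_C]
  have hq : ∀ x : Fin n → Bool,
      MvPolynomial.eval (fun j => if x j then (1 : ZMod 2) else 0)
          (bind₁ (fun j => X j + C (if t j then (1 : ZMod 2) else 0)) p) =
        MvPolynomial.eval (fun j => if (bxor x t) j then (1 : ZMod 2) else 0) p := fun x => by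
    rw [dd_eval_shift]
    exact congrArg (fun F => MvPolynomial.eval F p) (funext fun j => (dd_point (x j) (t j)).symm)
  -- `[a + b = 1] = [a = 1] ⊕ [b = 1]` in `𝔽₂` (pattern `Negative.zmod2_decide_add`)
  have hdec : ∀ a b : ZMod 2, decide (a + b = 1) = (decide (a = 1) ^^ decide (b = 1)) := by
    decide
  refine ⟨p + bind₁ (fun j => X j + C (if t j then (1 : ZMod 2) else 0)) p,
    dd_totalDegree _ hf1 hf0 hp, fun x => ?_⟩
  show (e x ^^ e (bxor x t)) = polyPhase _ x
  rw [hpe, hpe, polyPhase_apply, polyPhase_apply, polyPhase_apply, map_add, hq, hdec]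

end Summit.QuantumAdvantage.QuantumAdvantage.Theorems.CubicForrelation.NearExactIsExact
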